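import Summits.BirchSwinnertonDyer.BirchSwinnertonDyer.Theorems.PrintCf2RubinValueTwoRowTwoTwistedKummerRoots
import Literature.NumberTheory.ComplexMultiplication.EllipticUnits.KatoLayerRamification
import Literature.NumberTheory.GaloisRepresentations.GaloisSubgroups
import HarnessLib

/-!
# Kato's `p`-units are `S`-units for `S = supp(p𝔣)`; twisted Kummer classes of `p`-UNITS (the root/class
# constructor of ROW 2 FILE 3g for `pUnitsOf` instead of `globalUnitsOf`), and at Kato's levels `K(p^s𝔣)`

Cell `bsd-print-cf2` (HOME `run/shared/lean/pub/bsd-print-cf2/`), width seat `bsd-line-cf2-p1-w2` g17 — bridge (B1)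
of `bsd-line-cf2-p1-w5` g9's F0B-ASSEMBLY-PLAN (step 1: "`pUnitsOf p (katoLayer p 𝔣 s) ≤ sUnits K (suppPF p 𝔣) K̄`",
step 2: the twisted Kummer class of a root of a Kato representative at level `U_s = Gal(K̄/K(p^s𝔣))`), offered
15:04:26Z; `--supports` stmt-BirchSwinnertonDyer-24721 (helper). THEOREMS ONLY, Theses-free.

Kato §15.1 (p. 251): `𝔥¹ = lim← O_{K′}[1/p]^× ⊗ ℤ_p`; §15.5: `_𝔞z_𝔣 ∈ K(𝔣)^×` "is a `𝔭`-unit" — the tree's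
`pUnitsOf p F` (`u ∈ F`, `p^k u` and `p^k u⁻¹` algebraic integers). Johnson-Leung–Kings §3.3 (5)/Cor. 3.4: the
`t_p(θ)`-twisted Kummer map on `𝒪_F[1/S]^× ⊗ ℤ_p`, `S ⊇ {v ∣ p}`. WHAT IS PROVED: `inv_natCast_mem_integer`
(`p⁻¹ ∈ 𝒪_{K,S}` for `S ⊇ {v ∣ p}`), `isIntegral_integer_of_isIntegral_pow_mul`, **`pUnitsOf_le_sUnits`** (B1),
**`exists_root_isTwistedKummerClass_of_mem_pUnitsOf`** (ROW 2's `exists_root_isTwistedKummerClass` for `p`-units: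
a `p^k`-th root `β` of `u` and a class of `β` at `U = Gal(K̄/F)`, `N_S ≤ U`, `θ|_U = 1`), and the Kato-level form
**`exists_root_isTwistedKummerClass_katoLayer`** (`F = K(p^s𝔣)`, `S = supp(p𝔣)`, `U = katoLevelSubgroup p 𝔣 s`, `θ`
trivial on `Gal(K̄/K(𝔣))`; for a Kato representative `u`, applied to `u⁻¹`: `β^{p^k} = u⁻¹` as in the pin (Z1)).
HONEST FRAMING: bookkeeping; nothing about an elliptic curve; BSD is not advanced.

## References
* [Kato2004Asterisque] K. Kato, Astérisque 295 (2004), §15.1 (p. 251), §15.5 (p. 253).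
* [JohnsonLeungKings2011] J. Johnson-Leung, G. Kings, J. reine angew. Math. 653 (2011), §3.3 (5)–(6), Cor. 3.4
  (arXiv:0804.2828 p0010:L40–80).
* [NeukirchSchmidtWingberg2008] J. Neukirch, A. Schmidt, K. Wingberg, *Cohomology of Number Fields* (2008), VIII §3.
-/

set_option linter.dupNamespace false -- `Summit.BirchSwinnertonDyer.BirchSwinnertonDyer` (summit = problem) is the tree's layout
set_option autoImplicit false

noncomputable section

open scoped Classical NumberField
open Field NumberField IsDedekindDomain
open Literature.NumberTheory.NumberFields (rayClassField)
open Literature.NumberTheory.GaloisRepresentations Literature.NumberTheory.GaloisRepresentations.LocalWeilDatum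
open Literature.NumberTheory.ComplexMultiplication.EllipticUnits
open Literature.NumberTheory.ComplexMultiplication.EllipticUnits.JohnsonLeungKings2011
open Summit.BirchSwinnertonDyer.BirchSwinnertonDyer.Theorems.PrintCf2.RowTwo

namespace Summit.BirchSwinnertonDyer.BirchSwinnertonDyer.Theorems.PrintCf2.KatoPUnits

variable {K : Type} [Field K] [NumberField K] (p : ℕ) [Fact p.Prime] (S : Set (HeightOneSpectrum (𝓞 K)))

/-! ## §1. `p`-units are `S`-units for `S ⊇ {v ∣ p}` -/

omit [Fact p.Prime] in
/-- **`p⁻¹ ∈ 𝒪_{K,S}` when `S` contains every prime above `p`**: at `v ∉ S`, `v ∤ p`, so `|p|_v = 1`.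
[cite: NeukirchSchmidtWingberg2008, VIII §3 (`𝒪_{K,S}`, `S ⊇ S_p`)] -/
theorem inv_natCast_mem_integer (hSp : ∀ v : HeightOneSpectrum (𝓞 K), ((p : ℕ) : 𝓞 K) ∈ v.asIdeal → v ∈ S) :
    ((p : K))⁻¹ ∈ S.integer K := by
  intro v hv
  have hpv : ((p : ℕ) : 𝓞 K) ∉ v.asIdeal := fun h ↦ hv (hSp v h)
  have h1 : v.valuation K (algebraMap (𝓞 K) K ((p : ℕ) : 𝓞 K)) = 1 :=
    (v.valuation_eq_one_iff_notMem (K := K)).mpr hpv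
  rw [map_natCast] at h1
  rw [map_inv₀, h1, inv_one]

/-- **An element `x ∈ K̄` with `p^k x` an algebraic integer is integral over `𝒪_{K,S}`** (`S ⊇ {v ∣ p}`):
`x = (p⁻¹)^k · (p^k x)` with `p⁻¹ ∈ 𝒪_{K,S}`. [cite: NeukirchSchmidtWingberg2008, VIII §3] -/
theorem isIntegral_integer_of_isIntegral_pow_mul
    (hSp : ∀ v : HeightOneSpectrum (𝓞 K), ((p : ℕ) : 𝓞 K) ∈ v.asIdeal → v ∈ S) {x : AlgebraicClosure K} {k : ℕ}
    (hx : IsIntegral ℤ ((p : AlgebraicClosure K) ^ k * x)) : IsIntegral (S.integer K) x := by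
  have hp0 : (p : AlgebraicClosure K) ≠ 0 := Nat.cast_ne_zero.mpr (Fact.out : p.Prime).ne_zero
  let c : S.integer K := ⟨((p : K))⁻¹, inv_natCast_mem_integer p S hSp⟩ ^ k
  have hc : algebraMap (S.integer K) (AlgebraicClosure K) c = ((p : AlgebraicClosure K))⁻¹ ^ k := by
    simp only [c, map_pow]
    congr 1
    change algebraMap K (AlgebraicClosure K) ((p : K))⁻¹ = _
    rw [map_inv₀, map_natCast]
  have e : x = algebraMap (S.integer K) (AlgebraicClosure K) c * ((p : AlgebraicClosure K) ^ k * x) := by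
    rw [hc, ← mul_assoc, ← mul_pow, inv_mul_cancel₀ hp0, one_pow, one_mul]
  rw [e]
  exact isIntegral_algebraMap.mul hx.tower_top

/-- **(B1) Kato's `p`-units are `S`-units: `pUnitsOf p F ≤ 𝒪_{K̄,S}^×` for `S ⊇ {v ∣ p}`** (`O_F[1/p]^× ⊂ O_F[1/S]^×`).
[cite: Kato2004Asterisque, §15.1 (p. 251, "O_{K′}[1/p]^×")] [cite: NeukirchSchmidtWingberg2008, VIII §3] -/
theorem pUnitsOf_le_sUnits (hSp : ∀ v : HeightOneSpectrum (𝓞 K), ((p : ℕ) : 𝓞 K) ∈ v.asIdeal → v ∈ S)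
    (F : IntermediateField K (AlgebraicClosure K)) : pUnitsOf p F ≤ SUnits.sUnits K S (AlgebraicClosure K) := by
  rintro u ⟨-, k, hk, hk'⟩
  exact ⟨isIntegral_integer_of_isIntegral_pow_mul p S hSp hk,
    isIntegral_integer_of_isIntegral_pow_mul p S hSp (by simpa using hk')⟩

/-! ## §2. Twisted Kummer classes of roots of `p`-units -/

variable (θ : absoluteGaloisGroup K →ₜ* ℤ_[p]ˣ) (k : ℕ)

/-- **THE `p`-UNIT CONSTRUCTOR** (ROW 2's `exists_root_isTwistedKummerClass` with `globalUnitsOf` replaced by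
`pUnitsOf`): for `S ⊇ {v ∣ p}`, `F/K` finite with `N_S ≤ Gal(K̄/F)` and `θ|_{Gal(K̄/F)} = 1`, every `p`-unit `u` of
`F` has a `p^k`-th root `β ∈ K̄` and a `t_p(θ)`-twisted Kummer class `c ∈ H¹(G_S(F), μ_{p^k} ⊗ θ)` of `β`
(Cor. 3.4: "`𝒪_F[1/p]^× ⊗ ℤ_p ⊂ H¹(𝒪_F[1/p], ℤ_p(1))`"). [cite: JohnsonLeungKings2011, §3.3 (5)–(6) and Cor. 3.4 (arXiv p0010:L40–70)]
[cite: Kato2004Asterisque, §15.1 (p. 251)] -/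
theorem exists_root_isTwistedKummerClass_of_mem_pUnitsOf
    (hSp : ∀ v : HeightOneSpectrum (𝓞 K), ((p : ℕ) : 𝓞 K) ∈ v.asIdeal → v ∈ S)
    (F : IntermediateField K (AlgebraicClosure K)) [FiniteDimensional K F]
    (hNF : ramificationSubgroup K S ≤ galFixing K F) (hθF : ∀ σ ∈ galFixing K F, θ σ = 1)
    {u : (AlgebraicClosure K)ˣ} (hu : u ∈ pUnitsOf p F) :
    ∃ (β : (AlgebraicClosure K)ˣ) (c : levelCoh p S θ (galFixing K F) k 1),
      β ^ (p ^ k) = u ∧ IsTwistedKummerClass p θ S (galFixing K F) k β c := by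
  have huF : (u : AlgebraicClosure K) ∈ F := hu.1
  have huN : ∀ τ ∈ ramificationSubgroup K S, τ • u = u := fun τ hτ ↦
    smul_units_eq_self_of_mem_galFixing (hNF hτ) huF
  obtain ⟨β, hβu, -, hβN⟩ := exists_pow_eq_of_mem_sUnits p S hSp (pUnitsOf_le_sUnits p S hSp F hu) huN k
  have hβU : ∀ σ ∈ galFixing K F, (σ • β / β) ^ (p ^ k) = 1 := by
    intro σ hσ
    rw [div_pow, ← smul_pow', hβu, smul_units_eq_self_of_mem_galFixing hσ huF, div_self']
  obtain ⟨c, hc⟩ := exists_isTwistedKummerClass p S θ k (galFixing K F) (isOpen_galFixing K F) hθF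
    (fun τ hτ ↦ hθF τ (hNF hτ))
    (fun _ hτ ζ hζ ↦ smul_eq_self_of_mem_ramificationSubgroup_of_units_pow_eq_one p S k hSp hτ ζ hζ) β hβN hβU
  exact ⟨β, c, hβu, hc⟩

/-! ## §3. At Kato's levels `K(p^s𝔣)`, `S = supp(p𝔣)` -/

variable (𝔣 : Ideal (𝓞 K))

omit [Fact p.Prime] in
/-- Every prime above `p` lies in `supp(p𝔣)`. [cite: JohnsonLeungKings2011, Cor. 5.3 (arXiv p0015:L1–3)] -/
theorem mem_suppPF_of_natCast_mem {v : HeightOneSpectrum (𝓞 K)} (hv : ((p : ℕ) : 𝓞 K) ∈ v.asIdeal) :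
    v ∈ suppPF p 𝔣 := by
  change v.asIdeal ∣ Ideal.span {((p : ℕ) : 𝓞 K)} * 𝔣
  exact dvd_mul_of_dvd_left ((Ideal.dvd_span_singleton).mpr hv) 𝔣

omit [Fact p.Prime] in
/-- `Gal(K̄/K(p^s𝔣))` in the two currencies: `katoLevelSubgroup p 𝔣 s = galFixing K (katoLayer p 𝔣 s)`.
[cite: Kato2004Asterisque, §15.1 (p. 250)] -/
theorem katoLevelSubgroup_eq_galFixing (s : ℕ) :
    katoLevelSubgroup p 𝔣 s = galFixing K (katoLayer p 𝔣 s) :=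
  (galFixing_eq_absGaloisFixingSubgroup (katoLayer p 𝔣 s)).symm

/-- **THE KATO-LEVEL CONSTRUCTOR**: for `θ` trivial on `Gal(K̄/K(𝔣))`, `𝔣 ≠ 0`, every `p`-unit `u` of `K(p^s𝔣)` — in
particular a Kato representative (`IsKatoUnitRep p ι 𝔣 s 𝔞 u`), or its inverse — has a `p^k`-th root `β` and a twisted
Kummer class `c ∈ H¹(G_S(K(p^s𝔣)), μ_{p^k} ⊗ θ)` of `β`, `S = supp(p𝔣)`, at the level `U_s = katoLevelSubgroup p 𝔣 s`
(the witnesses `(β, c)` of the pin (Z1), before corestriction). [cite: JohnsonLeungKings2011, Def. 3.2, §3.3 (5), Def. 3.5 (arXiv p0009:L55–p0010:L80)]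
[cite: Kato2004Asterisque, §15.5 (p. 253)] -/
theorem exists_root_isTwistedKummerClass_katoLayer (h𝔣 : 𝔣 ≠ ⊥)
    (hθ : ∀ σ ∈ absGaloisFixingSubgroup (rayClassField K 𝔣), θ σ = 1) (s : ℕ)
    {u : (AlgebraicClosure K)ˣ} (hu : u ∈ pUnitsOf p (katoLayer p 𝔣 s)) :
    ∃ (β : (AlgebraicClosure K)ˣ) (c : levelCoh p (suppPF p 𝔣) θ (katoLevelSubgroup p 𝔣 s) k 1),
      β ^ (p ^ k) = u ∧ IsTwistedKummerClass p θ (suppPF p 𝔣) (katoLevelSubgroup p 𝔣 s) k β c := by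
  have hθs : ∀ σ ∈ katoLevelSubgroup p 𝔣 s, θ σ = 1 := by
    intro σ hσ
    refine hθ σ ?_
    have h0 : katoLevelSubgroup p 𝔣 0 = absGaloisFixingSubgroup (rayClassField K 𝔣) := by
      show absGaloisFixingSubgroup (rayClassField K (katoModulus p 𝔣 0)) = _
      rw [katoModulus_zero]
    exact h0 ▸ katoLevelSubgroup_antitone p 𝔣 h𝔣 (Nat.zero_le s) hσ
  have hN : ramificationSubgroup K (suppPF p 𝔣) ≤ galFixing K (katoLayer p 𝔣 s) :=
    (ramificationSubgroup_suppPF_le_katoLevelSubgroup p 𝔣 h𝔣 s).trans (katoLevelSubgroup_eq_galFixing p 𝔣 s).le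
  rw [katoLevelSubgroup_eq_galFixing]
  exact exists_root_isTwistedKummerClass_of_mem_pUnitsOf p (suppPF p 𝔣) θ k
    (fun v hv ↦ mem_suppPF_of_natCast_mem p 𝔣 hv) (katoLayer p 𝔣 s) hN
    (fun σ hσ ↦ hθs σ ((katoLevelSubgroup_eq_galFixing p 𝔣 s).symm ▸ hσ)) hu

/-- The same for the INVERSE of a Kato representative (`β^{p^k} = u⁻¹`, the shape of the pin (Z1)).
[cite: JohnsonLeungKings2011, Def. 3.2 and Def. 3.5 (arXiv p0009:L55–p0010:L80)] [cite: Kato2004Asterisque, §15.5 (p. 253)] -/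
theorem exists_root_isTwistedKummerClass_katoUnitRep_inv (h𝔣 : 𝔣 ≠ ⊥)
    (hθ : ∀ σ ∈ absGaloisFixingSubgroup (rayClassField K 𝔣), θ σ = 1) {ι : K →+* ℂ} {s : ℕ} {𝔞 : Ideal (𝓞 K)}
    {u : (AlgebraicClosure K)ˣ} (hu : IsKatoUnitRep p ι 𝔣 s 𝔞 u) :
    ∃ (β : (AlgebraicClosure K)ˣ) (c : levelCoh p (suppPF p 𝔣) θ (katoLevelSubgroup p 𝔣 s) k 1),
      β ^ (p ^ k) = u⁻¹ ∧ IsTwistedKummerClass p θ (suppPF p 𝔣) (katoLevelSubgroup p 𝔣 s) k β c :=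
  exists_root_isTwistedKummerClass_katoLayer p θ k 𝔣 h𝔣 hθ s ((pUnitsOf p (katoLayer p 𝔣 s)).inv_mem hu.1)

end Summit.BirchSwinnertonDyer.BirchSwinnertonDyer.Theorems.PrintCf2.KatoPUnits
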